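import Summits.Ventures.AbcSig.Rows.XTemplateAB2
import Summits.Ventures.AbcSig.Levels.N148
import Summits.Ventures.AbcSig.Levels.N296
import Summits.Ventures.AbcSig.Levels.N74
import Summits.Ventures.AbcSig.Levels.N74M6X

/-!
# Venture AbcSig — ROW `C2aL37A2AB`: `37^m·xⁿ + 2^2·yⁿ = z²` (second distribution), class `a = 2`, over the level files 148 (norm-form certificates) and 296 (ordinary tree certificates) and 74 (ordinary tree certificates) (GENERATED by p-lean g4 `gen4/c2arow2.py`)

HONEST FRAMING. A row of a COMPUTATION cell (`pub-abcsig`); a CONDITIONAL theorem, no claim on ABC or any summit.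
Hypotheses: `BS04Package` (CITED: [BS04] Lemma 3.3 + (3.1) + Lemma 4.2); `DataComplete` at both levels and `RefinesCPSymAll` at the
norm-form level(s) (COMPUTED: certified engine-1 level files; `Sieve/CharpolyCert.lean` / `Sieve/CharpolyTwist.lean`); `EisPackage` (CITED) + `Refines` (COMPUTED) for module-M6 residues discharged IN THE KERNEL at level 74;
and the listed per-orbit exclusions `hX_…` (CITED: the row of record's module closures — M4 Kraus / M6 / M8 / [BS04, Prop 4.4/4.6] as its R3
names them; nothing of those is checked here). Exponent range: prime `n ≥ 11`, `n ≠ 37`; `B = 2^2·37^m`, `1 ≤ m < n`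
(RULING H1 reduced exponents).
Levels 148 = 4·37 (norm-form, no residue ≥ 7), 296 = 8·37 and 74 = 2·37 (tree); the n = 19 residue of orbit_74_1 is DISCHARGED IN THE KERNEL by the module-M6 certificate (Levels/N74M6X.lean); residual of record: none; no cited exclusion.
Row of record: `census/rows/C2a/C2a-l37-a2.md` (sha16 `ed1a82a2960b4157`; R8-signed 2026-08-22T09:50:52Z by referee (ref-g5); T-BS13).
-/

namespace Summit.Ventures.AbcSig

/-- Row `C2aL37A2AB`: class `a = 2`, second distribution, prime `n ≥ 11`, `n ≠ 37`. -/
theorem xrow_C2aL37A2AB (M : NewformModel) (hP : M.BS04Package)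
    (hE : M.EisPackage)
    (hR_orbit_74_1 : M.Refines 74 orbit_74_1 m6X_74_1)
    (hD148 : M.DataComplete 148 level148Orbits) (hCP148 : M.RefinesCPSymAll 148 level148CP)
    (hD296 : M.DataComplete 296 level296Orbits)
    (hD74 : M.DataComplete 74 level74Orbits)
    (n : ℕ) (hn : n.Prime) (hmin : 11 ≤ n) (hnℓ : n ≠ 37) (m : ℕ) (hm : 1 ≤ m) (hmn : m < n)
    (x y z : ℤ) (hxy1 : x * y ≠ 1) (hxy2 : x * y ≠ -1) : ¬ IsPrimitiveSolution (37 ^ m) (2 ^ 2) 1 n x y z := by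
  have hℓ : Nat.Prime 37 := by norm_num
  have h7 : 7 ≤ n := by omega
  exact xrowC2aAB_a2 37 hℓ (by norm_num) M hP n hn h7 hnℓ hD148 hD296 hD74 m hm hmn
    (level148_sieve M hP hCP148 n hn h7 (fun o => M.Excludes 148 o
      (famAB (37 ^ m) (2 ^ 2) n (fun _ _ => True)) ∨ M.ExcludesStd 148 o n) (fun _ h => Or.inr h) )
    (level296_sieve n hn h7 (fun o => M.Excludes 296 o
      (famAB (37 ^ m) (2 ^ 2) n (fun _ _ => True)) ∨ M.ExcludesStd 296 o n) (fun hmem => by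
      obtain rfl : n = 7 := by simpa using hmem
      omega))
    (level74_sieve n hn h7 (fun o => M.Excludes 74 o
      (famAB (37 ^ m) (2 ^ 2) n (fun _ _ => True)) ∨ M.ExcludesStd 74 o n) (fun hmem => by
      obtain rfl : n = 19 := by simpa using hmem
      exact Or.inr (m6c_74_1_n19_excludes M hE hR_orbit_74_1)))
    x y z hxy1 hxy2

end Summit.Ventures.AbcSig
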